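import Summits.Ventures.AbcShadow.SH04.Statement17
import Summits.Ventures.AbcShadow.SH04.PairRow

/-!
# Venture AbcShadow — SH-04 GENERIC ROW for a pair `(p, n)` of [BVY04, Thm 1.7]: `xⁿ + p^α yⁿ = 3^β z³`, sieve + L\* route at level `243p`

HONEST FRAMING. A row template of the work-bound cell `abc-shadow` (typer seat `abc-shadow-typ-1`, lineage g3): a CONDITIONAL,
typed/kernel-checked REDUCTION, no claim on abc or on any summit, no side on IUT. The [Thm 1.7] analogue of `SH04/PairRow.lean`:
`p` prime, `p ≠ 3`, `n` prime, `n ≥ 7`, `p ≠ n`; after moving cubes into `z`, `C = 3^γ` with `γ = β mod 3 ∈ {1, 2}` (`β` coprime to `3`),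
so `3 ∣ C` and [Cor 3.3] gives the SINGLE row `ε′₃ = 3⁵`, level `Rad*(p^e)·Rad*(3^γ)²·3⁵ = 243p`. At that level an orbit is either
kernel-eliminated at `n`, or an L\* orbit whose congruences the kernel confines to the distinguished prime `𝔓 = (n, θ − r)` and whose named
hypothesis `LStarTransfer (243p) o n r 243 (−3)` (COMPUTED Sturm-bound congruence with a rational CM newform of level 243 + CITED transfer,
`SH04/LStar.lean`) makes `ρ^E_n` arise from a level-243 newform with CM by `ℚ(√−3)`; [BVY04, Prop 4.3] (`BVY04Prop43`) is then
discharged IN THE KERNEL: (a) `2` is inert in `ℚ(√−3)`; (b) needs `n ∈ {5, 7, 13}`: `n = 7` resp. `n = 13` are killed by the printed RANK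
INPUTS `J₀(21)` [BVY04 p.1407, Cremona 21A/63A] resp. `J₀(39)` [Kamienny] (`BVY04RankInput21/39`, demanded only at that `n`) together with
`3 ∤ ab` (here automatic: `3 ∣ C` and `Aa, Bb ⊥ Cc`). The sub-case `n ∣ α` is NOT Darmon–Merel here but [BVY04, Thm 1.5] at `C = 3`,
`α = 0` (`xⁿ + yⁿ = 3^β z³`: the printed theorem, named fact `thm15` of the Literature file, gives `α = 1`, absurd) — a CITED input.
`bvy17_pair … : SH04Pair17 p n` takes EXACTLY: `BVY04Package`, `BVY04Prop43`, `(n = 7 → BVY04RankInput21)`, `(n = 13 → BVY04RankInput39)`,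
ONE orbit list with its wellformedness / kernel-elimination-or-L\* facts, the COMPUTED `DataComplete (243p)`, and `thm15`. Everything else
is PROVED here, in the kernel, uniformly in `(p, n)`: `p ∤ xz`, `3 ∤ xy`; `α = nk + e`, `b = p^k y`, `1 ≤ e < n`; `β = 3m + γ`, `c = 3^m z`;
pairwise coprimality of `(Aa, Bb, Cc)`; print's normal form via `(A,a) ↔ (B,b)` (`Aaⁿ + Bbⁿ ≡ 0 (mod 3)` makes one of them `≢ 2`); `|ab| > 1`;
`C ∈ {3, 9}` cube-free; `p^e` `n`-th-power-free; `n ∤ 3^γ p^e`; `Rad*(p^e) = p`, `Rad*(3^γ) = 1`; the Prop 4.3 case analysis. Instances: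
`SH04/Row7_13.lean`, `SH04/Row13_7.lean`. Words: typed/kernel-checked REDUCTION; the newform data is COMPUTED (certificate 4a36c28685fe0350)
and enters as `DataComplete`; print inputs are NAMED hypotheses; the L\* congruence is COMPUTED + CITED and enters as ONE named hypothesis per
surviving orbit; adjacent (signature (n,n,3)), NOT abc; no side on IUT. AI-typed; weaker than expert refereeing of the cited inputs.
-/

namespace Summit.Ventures.AbcShadow

open Summit.Ventures.AbcSig (NewformModel FreyDatum OrbitData)
open Literature.NumberTheory.DiophantineGeometry.BennettVatsalYazdani2004 (thm15 thm15Coefficients)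

/-! ## Small arithmetic facts -/

/-- The level of a [Thm 1.7] pair: `Rad*(p^e) · Rad*(3^γ)² · 3⁵ = 243p` for `γ ∈ {1, 2}`, `e ≥ 1`, `p ≠ 3` prime (row `ε′₃ = 3⁵` of
[BVY04, Cor 3.3]). [cite: BennettVatsalYazdani2004, Cor 3.3 p.1405; Thm 1.7 (levels 3⁵ p)] -/
theorem bvy04Level_pair17 (p : ℕ) (hp : p.Prime) (hp3 : p ≠ 3) (A B e γ : ℕ) (he : e ≠ 0) (hAB : A * B = p ^ e)
    (hγ : γ = 1 ∨ γ = 2) : bvy04Level .C3 A B (3 ^ γ) = 243 * p := by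
  have hrad : radStar (3 ^ γ) = 1 := by
    rcases hγ with rfl | rfl <;> decide
  simp only [bvy04Level, hAB, radStar_prime_pow p e hp hp3 he, hrad, BVYCase.threeExp]
  ring

/-- `3^γ` is cube-free for `γ ∈ {1, 2}`. [folklore] -/
theorem cubefree_three_pow {γ : ℕ} (hγ : γ = 1 ∨ γ = 2) : ∀ q : ℕ, q.Prime → ¬ q ^ 3 ∣ 3 ^ γ := by
  intro q hq h
  have hq3 : q ∣ 3 ^ γ := (dvd_pow_self q (by norm_num)).trans h
  have := (Nat.prime_dvd_prime_iff_eq hq Nat.prime_three).mp (hq.dvd_of_dvd_pow hq3)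
  subst this
  have := (Nat.pow_dvd_pow_iff_le_right (by norm_num : 1 < 3)).mp h
  omega

/-! ## The core: a datum in print's normal form at the level `243p` -/

/-- **Core of the generic [Thm 1.7] row** (normal form). `p ≠ 3` prime, `n ≥ 7` prime, `p ≠ n`; `N = 243p` with orbit list `L` (entries at odd
primes not dividing `N`); every orbit of `L` is kernel-eliminated at `n` OR is an L\* orbit (kernel distinguished prime `θ ≡ r` + named
`LStarTransfer N o n r 243 (−3)`). Then under `BVY04Package`, `BVY04Prop43`, the rank input at `n ∈ {7, 13}` and `DataComplete N L` there is
no datum `A aⁿ + B bⁿ = 3^γ c³` with `A·B = p^e`, `1 ≤ e < n`, `γ ∈ {1, 2}`, `Aa, Bb, 3^γ c` pairwise coprime and nonzero, `Bbⁿ ≢ 2 (mod 3)`,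
`ab ≠ ±1`. [L.3.4 + Cor 3.3, row `3 ∣ C`] give a newform of level `243p` with the [Prop 4.2] congruences at `n`; `DataComplete` puts it in a
listed orbit; a kernel tree kills it, or (L\*) `ρ^E_n` arises from a CM-by-`ℚ(√−3)` newform of level 243 and [Prop 4.3] fails: (a) `2` inert;
(b) `n ∈ {7, 13}` needs no rank-0 quotient of `J₀(3n)` (contradicting the printed rank input) or `3 ∣ ab` (contradicting `3 ∣ C`).
[cite: BennettVatsalYazdani2004, Lemma 3.4 p.1406, Cor 3.3 p.1405, Prop 4.2 pp.1406-1407, Prop 4.3 p.1407] -/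
theorem bvy17_core (p n : ℕ) (hp : p.Prime) (hp3 : p ≠ 3) (hn : n.Prime) (h7 : 7 ≤ n) (hpn : p ≠ n)
    (M : CMNewformModel) (hP : M.BVY04Package) (h43 : M.BVY04Prop43) (hR21 : n = 7 → M.BVY04RankInput21)
    (hR39 : n = 13 → M.BVY04RankInput39) {N : ℕ} (hNp : 243 * p = N) (L : List OrbitData)
    (hw : ∀ o ∈ L, ∀ c ∈ o.coeffs, c.ell.Prime ∧ c.ell ≠ 2 ∧ ¬ c.ell ∣ N)
    (he : ∀ o ∈ L, o.Eliminated bvy04AllowedPrint n ∨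
      ∃ r : ℤ, (∀ f : M.Form N, M.Matches f o → M.ArisesMod f n bvy04AllowedPrint →
        MatchesModAt M.toNewformModel f o n bvy04AllowedPrint r) ∧ M.LStarTransfer N o n r 243 (-3))
    (hD : M.DataComplete N L)
    {A B e γ : ℕ} (he1 : 1 ≤ e) (hen : e < n) (hAB : A * B = p ^ e) (hγ : γ = 1 ∨ γ = 2) {a b c : ℤ}
    (hsol : IsPrimitiveSolution A B (3 ^ γ) n a b c) (h3b : ¬ (3 : ℤ) ∣ (B : ℤ) * b ^ n - 2) (hab1 : a * b ≠ 1)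
    (hab2 : a * b ≠ -1) : False := by
  -- arithmetic of the coefficients
  have hpe : 0 < p ^ e := Nat.pow_pos hp.pos
  have hA0 : 0 < A := Nat.pos_of_ne_zero (fun h => by rw [h, zero_mul] at hAB; omega)
  have hB0 : 0 < B := Nat.pos_of_ne_zero (fun h => by rw [h, mul_zero] at hAB; omega)
  have hC0 : 0 < 3 ^ γ := Nat.pow_pos (by norm_num)
  have hAdvd : A ∣ p ^ e := Dvd.intro _ hAB
  have hBdvd : B ∣ p ^ e := Dvd.intro_left _ hAB
  have hfree : ∀ D : ℕ, D ∣ p ^ e → ∀ q : ℕ, q.Prime → ¬ q ^ n ∣ D := by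
    intro D hD q hq h
    have hqp : q ∣ p ^ e := (dvd_pow_self q (by omega : n ≠ 0)).trans (h.trans hD)
    have hq : q = p := (Nat.prime_dvd_prime_iff_eq hq hp).mp (hq.dvd_of_dvd_pow hqp)
    subst hq
    have := (Nat.pow_dvd_pow_iff_le_right hq.one_lt).mp (h.trans hD)
    omega
  have hnABC : ¬ n ∣ A * B * 3 ^ γ := by
    rw [hAB]
    intro h
    rcases (Nat.Prime.dvd_mul hn).mp h with h | h
    · exact hpn ((Nat.prime_dvd_prime_iff_eq hn hp).mp (hn.dvd_of_dvd_pow h)).symm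
    · have := (Nat.prime_dvd_prime_iff_eq hn Nat.prime_three).mp (hn.dvd_of_dvd_pow h)
      omega
  -- `3 ∣ C` and pairwise coprimality give `3 ∤ a`, `3 ∤ b`
  have hac := hsol.2.2.2.2.2.1
  have hbc := hsol.2.2.2.2.2.2
  have h3C : (3 : ℤ) ∣ ((3 ^ γ : ℕ) : ℤ) * c := by
    refine Dvd.dvd.mul_right ?_ _
    rcases hγ with rfl | rfl <;> norm_num
  have h3unit : ∀ {u : ℤ}, IsCoprime u (((3 ^ γ : ℕ) : ℤ) * c) → ¬ (3 : ℤ) ∣ u := by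
    intro u hu h3
    have hU : IsUnit (3 : ℤ) := hu.isUnit_of_dvd' h3 h3C
    rcases Int.isUnit_iff.mp hU with h | h <;> norm_num at h
  have h3Aa : ¬ (3 : ℤ) ∣ (A : ℤ) * a := h3unit hac
  have h3a' : ¬ (3 : ℤ) ∣ a := fun h => h3Aa (Dvd.dvd.mul_left h _)
  have h3b' : ¬ (3 : ℤ) ∣ b := fun h => h3unit hbc (Dvd.dvd.mul_left h _)
  have h5 : 5 ≤ n := by omega
  have hex1 : ¬ (A * B = 27 ∧ n = 5) := fun h => by omega
  have hex2 : ¬ (A * B = 3 ∧ n = 7) := by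
    rintro ⟨h, -⟩
    rw [hAB] at h
    have h3 : 3 ∣ p ^ e := by rw [h]
    exact hp3 ((Nat.prime_dvd_prime_iff_eq Nat.prime_three hp).mp (Nat.prime_three.dvd_of_dvd_pow h3)).symm
  let S : FreyDatum := ⟨A, B, 3 ^ γ, n, a, b, c⟩
  have hκ : BVYCase.C3.Holds A B (3 ^ γ) n a b c := by
    show 3 ∣ 3 ^ γ
    rcases hγ with rfl | rfl <;> norm_num
  obtain ⟨⟨f, hf⟩, hmod⟩ := hP S .C3 hA0 hB0 hC0 (cubefree_three_pow hγ)
    (fun q hq => ⟨hfree A hAdvd q hq, hfree B hBdvd q hq⟩) hn h5 hnABC h3Aa h3b hsol hab1 hab2 hex1 hex2 hκ N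
    ((bvy04Level_pair17 p hp hp3 A B e γ (by omega) hAB hγ).trans hNp)
  have hmodf := hmod f hf
  obtain ⟨o, ho, hfo⟩ := hD f
  rcases he o ho with helim | ⟨r, hAt, hL⟩
  · exact M.not_arisesMod_of_eliminated f o hfo n bvy04AllowedPrint helim (hw o ho) hmodf
  · -- the L\* orbit: `ρ^E_n` arises from a CM-by-`ℚ(√−3)` newform of level 243; [Prop 4.3] fails
    obtain ⟨g, hCM, hg⟩ := hL S rfl hsol hab1 hab2 f hf (hAt f hfo hmodf)
    have hsq : Squarefree (-3 : ℤ) := by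
      rw [← Int.squarefree_natAbs]
      exact Nat.prime_three.squarefree
    rcases h43 S 243 g (-3) hA0 hB0 hC0 (cubefree_three_pow hγ) (fun q hq => ⟨hfree A hAdvd q hq, hfree B hBdvd q hq⟩)
        hn h5 h3Aa h3b hsol hab1 hab2 hg (by norm_num) hsq hCM with ⟨-, -, hs2⟩ | ⟨hn513, -, halt⟩
    · simp [QuadSplits] at hs2
    · have hSn : S.n = n := rfl
      rw [hSn] at hn513 halt
      have h3ab : ¬ ((∃ r s : ℕ, 0 < s ∧ (S.a * S.b = 2 ^ r * 3 ^ s ∨ S.a * S.b = -(2 ^ r * 3 ^ s))) ∧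
          QuadRamifies 3 (-3)) := by
        rintro ⟨⟨r', s, hs, hrs⟩, -⟩
        have h3ab : (3 : ℤ) ∣ a * b := by
          have h3 : (3 : ℤ) ∣ 2 ^ r' * 3 ^ s := Dvd.dvd.mul_left (dvd_pow_self 3 hs.ne') _
          rcases hrs with h | h
          · exact (show S.a * S.b = a * b from rfl) ▸ h ▸ h3
          · exact (show S.a * S.b = a * b from rfl) ▸ h ▸ h3.neg_right
        rcases Int.prime_three.dvd_or_dvd h3ab with h | h
        · exact h3a' h
        · exact h3b' h
      rcases hn513 with h5' | h7' | h13'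
      · omega
      · rcases halt with hJ | hrs
        · rw [h7'] at hJ
          exact hJ (hR21 h7')
        · exact h3ab hrs
      · rcases halt with hJ | hrs
        · rw [h13'] at hJ
          exact hJ (hR39 h13')
        · exact h3ab hrs

/-! ## The generic [Thm 1.7] row -/

/-- `p ∤ x`, `p ∤ z`, `3 ∤ x`, `3 ∤ y` for a pairwise-coprime solution of `xⁿ + p^α yⁿ = 3^β z³` (`α, β, n ≥ 1`, `p ≠ 3` prime). [folklore] -/
theorem sh04_not_dvd17 {p n α β : ℕ} (hp : p.Prime) (hp3 : p ≠ 3) (hα : 0 < α) (hβ : 0 < β) (hn : 0 < n) {x y z : ℤ}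
    (hxy : IsCoprime x y) (hxz : IsCoprime x z) (heq : x ^ n + (p : ℤ) ^ α * y ^ n = 3 ^ β * z ^ 3) :
    ¬ (p : ℤ) ∣ x ∧ ¬ (p : ℤ) ∣ z ∧ ¬ (3 : ℤ) ∣ x ∧ ¬ (3 : ℤ) ∣ y := by
  have pP : Prime (p : ℤ) := Int.prime_iff_natAbs_prime.mpr (by simpa using hp)
  have hpd : (p : ℤ) ∣ (p : ℤ) ^ α * y ^ n := Dvd.dvd.mul_right (dvd_pow_self (p : ℤ) hα.ne') _
  have h3d : (3 : ℤ) ∣ 3 ^ β * z ^ 3 := Dvd.dvd.mul_right (dvd_pow_self (3 : ℤ) hβ.ne') _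
  have hp3' : ¬ (p : ℤ) ∣ 3 ^ β := by
    intro h
    have h1 : (p : ℤ) ∣ 3 := Int.Prime.dvd_pow' hp (by exact_mod_cast h : (p : ℤ) ∣ (3 : ℤ) ^ β)
    have h2 : p ∣ 3 := by exact_mod_cast h1
    exact hp3 ((Nat.prime_dvd_prime_iff_eq hp Nat.prime_three).mp h2)
  have key : ∀ {u v : ℤ} (q : ℤ), Prime q → IsCoprime u v → q ∣ u → q ∣ v → False := by
    intro u v q hq huv hu hv
    exact hq.not_unit (huv.isUnit_of_dvd' hu hv)
  refine ⟨?_, ?_, ?_, ?_⟩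
  · intro hx
    have hz3 : (p : ℤ) ∣ 3 ^ β * z ^ 3 := by
      rw [← heq]
      exact dvd_add (dvd_pow hx hn.ne') hpd
    rcases pP.dvd_or_dvd hz3 with h | h
    · exact hp3' h
    · exact key (p : ℤ) pP hxz hx (pP.dvd_of_dvd_pow h)
  · intro hz
    have hxn : (p : ℤ) ∣ x ^ n := by
      have : x ^ n = 3 ^ β * z ^ 3 - (p : ℤ) ^ α * y ^ n := by rw [← heq]; ring
      rw [this]
      exact dvd_sub (Dvd.dvd.mul_left (dvd_pow hz (by norm_num)) _) hpd
    exact key (p : ℤ) pP hxz (pP.dvd_of_dvd_pow hxn) hz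
  · intro hx
    have hy' : (3 : ℤ) ∣ (p : ℤ) ^ α * y ^ n := by
      have : (p : ℤ) ^ α * y ^ n = 3 ^ β * z ^ 3 - x ^ n := by rw [← heq]; ring
      rw [this]
      exact dvd_sub h3d (dvd_pow hx hn.ne')
    rcases Int.prime_three.dvd_or_dvd hy' with h | h
    · have h1 : (3 : ℤ) ∣ (p : ℤ) := Int.prime_three.dvd_of_dvd_pow h
      have h2 : 3 ∣ p := by exact_mod_cast h1
      exact hp3 ((Nat.prime_dvd_prime_iff_eq Nat.prime_three hp).mp h2).symm
    · exact key 3 Int.prime_three hxy hx (Int.prime_three.dvd_of_dvd_pow h)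
  · intro hy
    have hx' : (3 : ℤ) ∣ x ^ n := by
      have : x ^ n = 3 ^ β * z ^ 3 - (p : ℤ) ^ α * y ^ n := by rw [← heq]; ring
      rw [this]
      exact dvd_sub h3d (Dvd.dvd.mul_left (dvd_pow hy hn.ne') _)
    exact key 3 Int.prime_three hxy (Int.prime_three.dvd_of_dvd_pow hx') hy

/-- **Generic [Thm 1.7] row for `n ∤ α`.** Under the hypotheses of `bvy17_core`: `xⁿ + p^α yⁿ = 3^β z³` (`α, β ≥ 1`, `3 ∤ β`) has no solution in
pairwise coprime integers with `|xy| > 1` when `n ∤ α`. Kernel steps: `p ∤ xz`, `3 ∤ xy`; `α = nk + e`, `Y = p^k y`; `β = 3m + γ`, `Z = 3^m z`,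
`γ ∈ {1, 2}`; pairwise coprimality of `(x, p^{e+k} y, 3^{γ+m} z)`; `|xY| > 1`; normal form via `(A,a) ↔ (B,b)`; then `bvy17_core`.
[cite: BennettVatsalYazdani2004, Thm 1.7 pp.1400-1401 (one pair (p,n)); Lemma 3.4, Cor 3.3, Prop 4.2, Prop 4.3] -/
theorem bvy17_pair_of_not_dvd (p n : ℕ) (hp : p.Prime) (hp3 : p ≠ 3) (hn : n.Prime) (h7 : 7 ≤ n) (hpn : p ≠ n)
    (M : CMNewformModel) (hP : M.BVY04Package) (h43 : M.BVY04Prop43) (hR21 : n = 7 → M.BVY04RankInput21)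
    (hR39 : n = 13 → M.BVY04RankInput39) {N : ℕ} (hNp : 243 * p = N) (L : List OrbitData)
    (hw : ∀ o ∈ L, ∀ c ∈ o.coeffs, c.ell.Prime ∧ c.ell ≠ 2 ∧ ¬ c.ell ∣ N)
    (he : ∀ o ∈ L, o.Eliminated bvy04AllowedPrint n ∨
      ∃ r : ℤ, (∀ f : M.Form N, M.Matches f o → M.ArisesMod f n bvy04AllowedPrint →
        MatchesModAt M.toNewformModel f o n bvy04AllowedPrint r) ∧ M.LStarTransfer N o n r 243 (-3))
    (hD : M.DataComplete N L)
    (α β : ℕ) (hα : 0 < α) (hβ : 0 < β) (hβ3 : Nat.Coprime β 3) (hnα : ¬ n ∣ α) (x y z : ℤ) (hxy : IsCoprime x y)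
    (hxz : IsCoprime x z) (hyz : IsCoprime y z) (hbig : 1 < |x * y|) (heq : x ^ n + (p : ℤ) ^ α * y ^ n = 3 ^ β * z ^ 3) :
    False := by
  have hn0 : 0 < n := by omega
  obtain ⟨hpx, hpz, h3x, h3y⟩ := sh04_not_dvd17 hp hp3 hα hβ hn0 hxy hxz heq
  -- `α = n k + e`, `β = 3 m + γ`
  set k := α / n with hk
  set e := α % n with hee
  have hαke : α = n * k + e := (Nat.div_add_mod α n).symm
  have he1 : 1 ≤ e := Nat.pos_of_ne_zero (fun h0 => hnα (Nat.dvd_of_mod_eq_zero h0))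
  have hen : e < n := Nat.mod_lt α hn0
  set m := β / 3 with hm
  set γ := β % 3 with hγ'
  have hβmg : β = 3 * m + γ := (Nat.div_add_mod β 3).symm
  have hγ : γ = 1 ∨ γ = 2 := by
    have hlt : γ < 3 := Nat.mod_lt β (by norm_num)
    have hne : γ ≠ 0 := fun h0 => by
      have h3 : 3 ∣ β := Nat.dvd_of_mod_eq_zero h0
      exact absurd ((Nat.coprime_comm.mp hβ3).eq_one_of_dvd h3) (by norm_num)
    omega
  set Y : ℤ := (p : ℤ) ^ k * y with hY
  set Z : ℤ := (3 : ℤ) ^ m * z with hZ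
  have hpow : (p : ℤ) ^ α * y ^ n = ((p ^ e : ℕ) : ℤ) * Y ^ n := by
    rw [hαke, hY]; push_cast; ring
  have hpowC : (3 : ℤ) ^ β * z ^ 3 = ((3 ^ γ : ℕ) : ℤ) * Z ^ 3 := by
    rw [hβmg, hZ]; push_cast; ring
  -- nonvanishing and coprimality
  have hx0 : x ≠ 0 := by rintro rfl; simp at hbig
  have hy0 : y ≠ 0 := by rintro rfl; simp at hbig
  have hz0 : z ≠ 0 := by
    rintro rfl
    have hx1 := Int.isUnit_iff_abs_eq.mp (isCoprime_zero_right.mp hxz)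
    have hy1 := Int.isUnit_iff_abs_eq.mp (isCoprime_zero_right.mp hyz)
    rw [abs_mul, hx1, hy1] at hbig
    norm_num at hbig
  have pP : Prime (p : ℤ) := Int.prime_iff_natAbs_prime.mpr (by simpa using hp)
  have hcpx : IsCoprime (p : ℤ) x := pP.irreducible.coprime_iff_not_dvd.mpr hpx
  have hcpz : IsCoprime (p : ℤ) z := pP.irreducible.coprime_iff_not_dvd.mpr hpz
  have hc3x : IsCoprime (3 : ℤ) x := Int.prime_three.irreducible.coprime_iff_not_dvd.mpr h3x
  have hc3y : IsCoprime (3 : ℤ) y := Int.prime_three.irreducible.coprime_iff_not_dvd.mpr h3y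
  have hcp3 : IsCoprime (p : ℤ) 3 := Nat.isCoprime_iff_coprime.mpr ((Nat.coprime_primes hp Nat.prime_three).mpr hp3)
  have hBY : ((p ^ e : ℕ) : ℤ) * Y = (p : ℤ) ^ (e + k) * y := by rw [hY]; push_cast; ring
  have hCC : ((3 ^ γ : ℕ) : ℤ) * Z = (3 : ℤ) ^ (γ + m) * z := by rw [hZ]; push_cast; ring
  have hxBY : IsCoprime x (((p ^ e : ℕ) : ℤ) * Y) := by
    rw [hBY]
    exact (hcpx.symm.pow_right).mul_right hxy
  have hxCC : IsCoprime x (((3 ^ γ : ℕ) : ℤ) * Z) := by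
    rw [hCC]
    exact (hc3x.symm.pow_right).mul_right hxz
  have hBYCC : IsCoprime (((p ^ e : ℕ) : ℤ) * Y) (((3 ^ γ : ℕ) : ℤ) * Z) := by
    rw [hBY, hCC]
    exact (((hcp3.pow_right).mul_right hcpz).pow_left).mul_left ((hc3y.symm.pow_right).mul_right hyz)
  have hBY0 : ((p ^ e : ℕ) : ℤ) * Y ≠ 0 := by
    rw [hBY]; exact mul_ne_zero (pow_ne_zero _ (by exact_mod_cast hp.ne_zero)) hy0
  have hCC0 : ((3 ^ γ : ℕ) : ℤ) * Z ≠ 0 := by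
    rw [hCC]; exact mul_ne_zero (pow_ne_zero _ (by norm_num)) hz0
  have h1p : (1 : ℤ) ≤ |(p : ℤ)| := by
    rw [Nat.abs_cast]; exact_mod_cast hp.one_lt.le
  have hxY : x * Y ≠ 1 ∧ x * Y ≠ -1 := by
    have hlt : 1 < |x * Y| := by
      rw [hY, show x * ((p : ℤ) ^ k * y) = (p : ℤ) ^ k * (x * y) by ring, abs_mul]
      calc (1 : ℤ) = 1 * 1 := by norm_num
        _ < |(p : ℤ) ^ k| * |x * y| := by
          apply mul_lt_mul' _ hbig (by norm_num) (abs_pos.mpr (pow_ne_zero _ (by exact_mod_cast hp.ne_zero)))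
          rw [abs_pow]; exact one_le_pow₀ h1p
    constructor <;> intro h <;> rw [h] at hlt <;> norm_num at hlt
  have heq' : x ^ n + ((p ^ e : ℕ) : ℤ) * Y ^ n = ((3 ^ γ : ℕ) : ℤ) * Z ^ 3 := by rw [← hpow, ← hpowC]; exact heq
  have h3sum : (3 : ℤ) ∣ x ^ n + ((p ^ e : ℕ) : ℤ) * Y ^ n := by
    rw [heq']
    refine Dvd.dvd.mul_right ?_ _
    rcases hγ with h | h <;> rw [h] <;> norm_num
  have hAB1 : 1 * p ^ e = p ^ e := one_mul _
  have hAB2 : p ^ e * 1 = p ^ e := mul_one _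
  -- print's normal form: `B bⁿ ≢ 2 (mod 3)`, reached by the swap `(A,a) ↔ (B,b)` if necessary
  by_cases h3B : (3 : ℤ) ∣ ((p ^ e : ℕ) : ℤ) * Y ^ n - 2
  · refine bvy17_core p n hp hp3 hn h7 hpn M hP h43 hR21 hR39 hNp L hw he hD he1 hen hAB2 hγ (a := Y) (b := x) (c := Z)
      ⟨by rw [← heq']; push_cast; ring, hBY0, by simpa using hx0, hCC0, by simpa using hxBY.symm, hBYCC, by simpa using hxCC⟩
      ?_ (by rw [mul_comm]; exact hxY.1) (by rw [mul_comm]; exact hxY.2)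
    push_cast
    omega
  · exact bvy17_core p n hp hp3 hn h7 hpn M hP h43 hR21 hR39 hNp L hw he hD he1 hen hAB1 hγ (a := x) (b := Y) (c := Z)
      ⟨by rw [← heq']; push_cast; ring, by simpa using hx0, hBY0, hCC0, by simpa using hxBY, by simpa using hxCC, hBYCC⟩
      h3B hxY.1 hxY.2

/-- **Generic row `(p, n)` of [BVY04, Thm 1.7] (reduction theorem).** Under the named hypotheses of `bvy17_core` and [BVY04, Thm 1.5] (named
fact `thm15`, used only for `n ∣ α`: then `p^α yⁿ = (p^k y)ⁿ` and `xⁿ + Yⁿ = 3^β z³` is Theorem 1.5 at `C = 3`, `α = 0`, whose conclusion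
`α = 1` is absurd), `xⁿ + p^α yⁿ = 3^β z³` has no solution in pairwise coprime integers with `|xy| > 1` for any `α ≥ 1`, `β ≥ 1` coprime to
`3`: `SH04Pair17 p n`. ADJACENT, NOT abc. [cite: BennettVatsalYazdani2004, Thm 1.7 pp.1400-1401 (one pair (p,n), conditionally on the named inputs); Thm 1.5 p.1400] -/
theorem bvy17_pair (p n : ℕ) (hp : p.Prime) (hp3 : p ≠ 3) (hn : n.Prime) (h7 : 7 ≤ n) (hpn : p ≠ n)
    (M : CMNewformModel) (hP : M.BVY04Package) (h43 : M.BVY04Prop43) (hR21 : n = 7 → M.BVY04RankInput21)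
    (hR39 : n = 13 → M.BVY04RankInput39) {N : ℕ} (hNp : 243 * p = N) (L : List OrbitData)
    (hw : ∀ o ∈ L, ∀ c ∈ o.coeffs, c.ell.Prime ∧ c.ell ≠ 2 ∧ ¬ c.ell ∣ N)
    (he : ∀ o ∈ L, o.Eliminated bvy04AllowedPrint n ∨
      ∃ r : ℤ, (∀ f : M.Form N, M.Matches f o → M.ArisesMod f n bvy04AllowedPrint →
        MatchesModAt M.toNewformModel f o n bvy04AllowedPrint r) ∧ M.LStarTransfer N o n r 243 (-3))
    (hD : M.DataComplete N L) (h15 : thm15) : SH04Pair17 p n := by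
  intro α β hα hβ hβ3 x y z hxy hxz hyz hbig heq
  by_cases hnα : n ∣ α
  · -- `α = n k`: `xⁿ + (p^k y)ⁿ = 3^β z³` is [BVY04, Thm 1.5] at `C = 3`, `α = 0` (conclusion `α = 1` absurd)
    obtain ⟨k, rfl⟩ := hnα
    obtain ⟨hpx, hpz, -, -⟩ := sh04_not_dvd17 hp hp3 hα hβ (by omega : 0 < n) hxy hxz heq
    have pP : Prime (p : ℤ) := Int.prime_iff_natAbs_prime.mpr (by simpa using hp)
    have hcpx : IsCoprime (p : ℤ) x := pP.irreducible.coprime_iff_not_dvd.mpr hpx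
    have hcpz : IsCoprime (p : ℤ) z := pP.irreducible.coprime_iff_not_dvd.mpr hpz
    have hxY : IsCoprime x ((p : ℤ) ^ k * y) := (hcpx.symm.pow_right).mul_right hxy
    have hYz : IsCoprime ((p : ℤ) ^ k * y) z := (hcpz.pow_left).mul_left hyz
    have h1p : (1 : ℤ) ≤ |(p : ℤ)| := by
      rw [Nat.abs_cast]; exact_mod_cast hp.one_lt.le
    have hbig' : 1 < |x * ((p : ℤ) ^ k * y)| := by
      rw [show x * ((p : ℤ) ^ k * y) = (p : ℤ) ^ k * (x * y) by ring, abs_mul]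
      calc (1 : ℤ) = 1 * 1 := by norm_num
        _ < |(p : ℤ) ^ k| * |x * y| := by
          apply mul_lt_mul' _ hbig (by norm_num) (abs_pos.mpr (pow_ne_zero _ (by exact_mod_cast hp.ne_zero)))
          rw [abs_pow]; exact one_le_pow₀ h1p
    have h3mem : (3 : ℕ) ∈ thm15Coefficients := by simp [thm15Coefficients]
    have hmax : max 3 4 < n := by
      rw [max_eq_right (by norm_num : (3 : ℕ) ≤ 4)]
      omega
    have heq' : x ^ n + 3 ^ 0 * ((p : ℤ) ^ k * y) ^ n = ((3 : ℕ) : ℤ) ^ β * z ^ 3 := by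
      push_cast
      rw [← heq]
      ring
    obtain ⟨-, -, hα1, -⟩ := h15 3 h3mem n hn hmax 0 β (by norm_num) (by norm_num) (by omega) x _ z hxY hxz hYz hbig' heq'
    exact absurd hα1 (by norm_num)
  · exact bvy17_pair_of_not_dvd p n hp hp3 hn h7 hpn M hP h43 hR21 hR39 hNp L hw he hD α β hα hβ hβ3 hnα x y z hxy hxz hyz
      hbig heq

end Summit.Ventures.AbcShadow
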